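import Summits.Ventures.AbcSig.Rows.XTemplateHalves
import Summits.Ventures.AbcSig.Levels.N4832

/-!
# Venture AbcSig — PARITY-HALF ROW `C2aL151A3yodd`: `xⁿ + 8·151^m·yⁿ = z²`, `y` odd (class `a = 3`, clean level only) over the NORM-FORM level file 4832 = 32·151 (GENERATED by p-lean g4 `gen4/halfrow.py`)

HONEST FRAMING. A row of a COMPUTATION cell (`pub-abcsig`); a CONDITIONAL theorem, no claim on ABC or any summit.
Hypotheses: `BS04Package` (CITED: [BS04] Lemma 3.3 + (3.1) + Lemma 4.2); `DataComplete 4832` + `RefinesCPSymAll 4832` (COMPUTED: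
certified engine-1 level file; norm-form certificates `Sieve/CharpolyCert.lean`, prime-ideal trees where the norm form is weaker);
the listed per-orbit exclusions `hX_…` (CITED: the row of record's module closures — nothing of them is checked here).
Only the parity half living at the single level 32·151 is claimed (the complementary half needs level 2·151, not certified).
Exponent range: prime `n ≥ 11`, `n ≠ 151`, n ∉ [19]; `1 ≤ m < n`.
Residual of record R = {19} EXCLUDED in the statement (hres). No cited exclusion needed: every (orbit, exponent ≥ 11) pair is killed in the kernel.
Row of record: `census/rows/C2a/C2a-l151-a3-yodd.md` (sha16 `51f1dddf29e3f66e`; SIGNED 2026-08-22T16:05:08Z by referee (ref-g11)).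
-/

namespace Summit.Ventures.AbcSig

/-- Parity-half row `C2aL151A3yodd` (`xⁿ + 8·151^m·yⁿ = z²`, `y` odd (class `a = 3`, clean level only)); prime `n ≥ 11`, `n ≠ 151`, `n ∉ [19]`; conditional on the named hypotheses. -/
theorem xrow_C2aL151A3yodd (M : NewformModel) (hP : M.BS04Package)
    (hD4832 : M.DataComplete 4832 level4832Orbits) (hCP4832 : M.RefinesCPSymAll 4832 level4832CP)
    (n : ℕ) (hn : n.Prime) (hmin : 11 ≤ n) (hnℓ : n ≠ 151) (hres : n ∉ ([19] : List ℕ)) (m : ℕ) (hm : 1 ≤ m) (hmn : m < n)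

    (x y z : ℤ) (hy : ¬ 2 ∣ y) (hxy1 : x * y ≠ 1) (hxy2 : x * y ≠ -1) : ¬ IsPrimitiveSolution 1 (2 ^ 3 * 151 ^ m) 1 n x y z := by
  have hℓ : Nat.Prime 151 := by norm_num
  have h7 : 7 ≤ n := by omega
  exact xrowC2a_a3_yodd 151 hℓ (by norm_num) M hP n hn h7 hnℓ hD4832 m hm hmn
    (level4832_sieve M hP hCP4832 n hn h7 (fun o => M.Excludes 4832 o
      (famB (2 ^ 3 * 151 ^ m) n (fun _ _ => True)) ∨ M.ExcludesStd 4832 o n) (fun _ h => Or.inr h) (fun hmem => by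
      obtain rfl : n = 7 := by simpa using hmem
      omega) (fun hmem => by
      obtain rfl : n = 7 := by simpa using hmem
      omega) (fun hmem => by
      obtain rfl : n = 19 := by simpa using hmem
      exact absurd (by simp) hres) (fun hmem => by
      obtain rfl : n = 19 := by simpa using hmem
      exact absurd (by simp) hres))
    x y z hy hxy1 hxy2

end Summit.Ventures.AbcSig
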